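import Literature.Barriers.CriticalPhenomena.GaussianDominationRouteExpansion
import Literature.Barriers.CriticalPhenomena.GaussianDominationRouteLaceExpansionProp61
import Literature.Barriers.CriticalPhenomena.GaussianDominationRouteLaceExpansionRemainder
import Literature.Barriers.CriticalPhenomena.GaussianDominationRouteLaceExpansionSymm
import Literature.Barriers.CriticalPhenomena.LaceExpansionIsingDeconvolutionConvAlgebra
import Literature.Barriers.CriticalPhenomena.LaceExpansionPcLimit
import Literature.Probability.Percolation.SiteConnectionTools
import HarnessLib

/-!
# The subcritical lace-expansion coefficient `Π_p = Σ_N (-1)^N Π^{(N)}_p` IS a lace coefficient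
# (`IsLaceCoefficientAt`) as soon as `Σ_N Σ_x Π^{(N)}_p(x) < ∞` — Heydenreich–van der Hofstad §6.3

Barrier catalogue `Literature/Barriers/CriticalPhenomena/` (D-0021); a proof file on the printed
line of `Hara2008_prop12Subcrit` (`LaceExpansionPcSubcrit.lean`: "a family `(Π_p)_{p<p_c}` with
`IsLaceCoefficientAt d p (Π_p)` …"), joining two vocabularies of this catalogue:

* the coefficients `Π^{(N)}_p = lacePi d p N` of Heydenreich–van der Hofstad Ch. 6, DEFINED in
  `GaussianDominationRouteLaceExpansion.lean` (nested expectations (6.2.7), (6.2.25), (6.2.27)),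
  for which Prop. 6.1 (the expansion with remainder (6.2.2), `HvdH2017_prop61_holds`), the
  remainder bound (6.3.1)–(6.3.2) (`HvdH2017_eq632_holds`) and the invariance under lattice
  automorphisms fixing the origin (`lacePiT_map`) are THEOREMS of the catalogue;
* the predicate `IsLaceCoefficientAt d p Φ` of `LaceExpansionPcSubcrit.lean` — Hara's form of the
  expansion, `τ_p = g + J ⋆ τ_p` with `g = δ₀ + Φ` (`laceSource Φ`), `J = 2dp D ⋆ g`
  (`laceKernel p Φ`), `Φ` `ℤ^d`-symmetric (`IsZdSymmetric`, the full hyperoctahedral group) and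
  absolutely summable — in terms of which `Hara2008_prop12Subcrit`, `Hara2008_piLeftLimit`,
  `Hara2008_prop12Pc` and finally `Hara2008_etaZeroXSpace` are stated and reduced
  (`LaceExpansionPcLimit.lean`, `LaceExpansionPcLeftLimit.lean`, `LaceExpansionEtaZeroXSpaceLeafInputs.lean`).

Main results (all `d ≥ 2`, `p < p_c`):

* `lacePiSum d p x = Σ_N (-1)^N Π^{(N)}_p(x)` — the full coefficient `Π_p` of (6.1.1)/(6.3.3);
* `lacePi_signedPerm`, `isZdSymmetric_lacePi`, `isZdSymmetric_lacePiSum` — `Π^{(N)}_p` and `Π_p`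
  are invariant under every signed coordinate permutation ("spatial symmetry", p. 74), from
  `lacePiT_map` and the graph automorphism `zdSignedPermIso`;
* `tau_eq_laceIdentity_of_summable` — if `Σ_N Σ_x Π^{(N)}_p(x) < ∞` (joint summability of
  `lacePi d p`), then (6.1.2) holds: `τ = δ₀ + J⋆τ + Π_p ⋆ (J⋆τ) + Π_p` with `J = p𝟙{· ∼ 0}`
  (`bondJ`), by letting `M → ∞` in (6.2.2): `Π_M → Π_p` pointwise with the summable majorant
  `Σ_N Π^{(N)}`, and `|R_M(x)| ≤ (Π^{(M)} ⋆ J ⋆ τ)(x) ≤ 2dp Σ_u Π^{(M)}(u) → 0` ((6.3.2)–(6.3.4)) —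
  the printed argument of §6.3, here under the bare convergence hypothesis instead of the
  geometric bounds of Lemma 8.4 used in `GaussianDominationRouteProp83.lean`;
* `laceKernel_eq_latticeConv` — Hara's kernel is `J ⋆ (δ₀ + Φ)`;
* `isLaceCoefficientAt_lacePiSum` — THE BRIDGE: under the same hypothesis,
  `IsLaceCoefficientAt d p (lacePiSum d p)` ((6.1.2) re-associated into `τ = g + (J⋆g) ⋆ τ`);
* `IsLaceCoefficientAt.eq_lacePiSum` — by uniqueness below `p_c` (`IsLaceCoefficientAt.unique`,
  Exercise 6.1), EVERY subcritical lace coefficient is `lacePiSum d p`: the existential family of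
  `Hara2008_prop12Subcrit` can only be the Hara–Slade coefficients.

What this isolates of `Hara2008_prop12Subcrit`: its clause (i) is reduced to the convergence
`Σ_N Σ_x Π^{(N)}_p(x) < ∞` for `p < p_c` — for `d ≥ 11` the content of the diagrammatic estimates
(Prop. 7.4, `HvdH2017_prop74`) and of the computer-assisted smallness of the triangle at `d = 11`
(Fitzner–van der Hofstad 2017; `FitznerVanDerHofstad2017_infraredBound`); the remaining clauses
(the `p`-uniform pointwise majorant, `Σ_x |x|²|Π_p(x)| ≤ C`, the infrared lower bound) are bounds on
these same coefficients.

## References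

* M. Heydenreich, R. van der Hofstad, *Progress in High-Dimensional Percolation and Random
  Graphs* (Springer 2017): (6.1.1)–(6.1.2), Prop. 6.1 ((6.2.2)–(6.2.3)), §6.3 ((6.3.1)–(6.3.4):
  "if `R_M → 0` and `Π_M → Π_p` … then (6.1.2) follows"), Exercise 6.1 (uniqueness), p. 74 and
  (7.1.15) (spatial symmetry), Cor. 8.13 ((8.5.1)).
* T. Hara, Ann. Probab. 36 (2008) 530–593: Prop. 1.2 (`Ĵ_p = 2dp D̂ ĝ_p`, `ĝ_p = 1 + Π̂_p`) and
  Appendix A (items 1–2).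
* T. Hara, G. Slade, Comm. Math. Phys. 128 (1990) 333–391: Prop. 2.3, (4.4)–(4.6).
-/

noncomputable section

namespace Literature.Barriers.CriticalPhenomena

open _root_.MeasureTheory _root_.Filter _root_.Topology Literature.Probability.LatticeModels
  Literature.Probability.Percolation
open SpreadOutIsing (delta0 latticeConv latticeConv_assoc_of_bdd latticeConv_comm latticeConv_delta0_left
  latticeConv_add_smul_left latticeConv_add_smul_right)
open scoped BigOperators ENNReal

variable {d : ℕ}

/-! ### The full coefficient `Π_p = Σ_N (-1)^N Π^{(N)}_p` -/

/-- **`Π_p(x) := Σ_{N ≥ 0} (-1)^N Π^{(N)}_p(x)`**, the lace-expansion coefficient of bond percolation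
((6.1.1): "`Π_p` … defined as an alternating sum"; (6.3.3)), as a `tsum` over `N` (it converges
absolutely whenever `N ↦ Π^{(N)}_p(x)` is summable, in particular under the hypothesis
`Summable (Function.uncurry (lacePi d p))` of this file).
[cite: HeydenreichVanDerHofstad2017, (6.1.1) and (6.3.3)] -/
def lacePiSum (d : ℕ) (p : unitInterval) (x : Site d) : ℝ :=
  ∑' N : ℕ, (-1 : ℝ) ^ N * lacePi d p N x

/-- Unfolding lemma. [folklore] -/
theorem lacePiSum_def (p : unitInterval) (x : Site d) :
    lacePiSum d p x = ∑' N : ℕ, (-1 : ℝ) ^ N * lacePi d p N x := rfl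

/-! ### Spatial symmetry under the full hyperoctahedral group -/

/-- **`Π^{(N)}_p(πεx) = Π^{(N)}_p(x)`** for every signed coordinate permutation: the events of Ch. 6
and `P_p` are invariant under the lattice automorphism `Site.signedPerm π ε`, which fixes `0`
(`lacePiT_map` with `zdSignedPermIso`). [cite: HeydenreichVanDerHofstad2017, p. 74 and (7.1.15)] -/
theorem lacePi_signedPerm (p : unitInterval) (N : ℕ) (π : Equiv.Perm (Fin d)) (ε : Fin d → ℤˣ)
    (x : Site d) : lacePi d p N (Site.signedPerm π ε x) = lacePi d p N x := by
  have h := lacePiT_map (zdSignedPermIso π ε) (by simp) p N x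
  rw [zdSignedPermIso_apply] at h
  have h0 : Site.signedPerm π ε x = 0 ↔ x = 0 :=
    (Site.signedPerm π ε).injective.eq_iff' (Site.signedPerm_zero π ε)
  rw [lacePi_def, lacePi_def, h]
  simp only [h0]

/-- `Π^{(N)}_p` is `ℤ^d`-symmetric. [cite: HeydenreichVanDerHofstad2017, p. 74] -/
theorem isZdSymmetric_lacePi (p : unitInterval) (N : ℕ) : IsZdSymmetric (lacePi d p N) :=
  fun π ε x => lacePi_signedPerm p N π ε x

/-- `Π_p` is `ℤ^d`-symmetric. [cite: HeydenreichVanDerHofstad2017, p. 74 ("spatial symmetry of x ↦ Π_p(x)")] -/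
theorem isZdSymmetric_lacePiSum (p : unitInterval) : IsZdSymmetric (lacePiSum d p) := fun π ε x => by
  simp only [lacePiSum_def, lacePi_signedPerm]

/-- `Π_p(-x) = Π_p(x)`. [cite: HeydenreichVanDerHofstad2017, (7.1.15)] -/
theorem lacePiSum_neg (p : unitInterval) (x : Site d) : lacePiSum d p (-x) = lacePiSum d p x := by
  simp only [lacePiSum_def, lacePi_neg]

/-! ### Consequences of the convergence `Σ_N Σ_x Π^{(N)}_p(x) < ∞` -/

section Summable

variable {p : unitInterval} (hfam : Summable (Function.uncurry (lacePi d p)))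
include hfam

/-- Each `Π^{(N)}_p` is summable. [folklore] -/
theorem summable_lacePi_of_uncurry (N : ℕ) : Summable (lacePi d p N) :=
  hfam.prod_factor N

/-- For each `x`, `N ↦ Π^{(N)}_p(x)` is summable. [folklore] -/
theorem summable_lacePi_nat (x : Site d) : Summable fun N => lacePi d p N x :=
  hfam.prod_symm.prod_factor x

/-- The majorant `x ↦ Σ_N Π^{(N)}_p(x)` is summable. [cite: HeydenreichVanDerHofstad2017, (6.3.3)] -/
theorem summable_tsum_lacePi : Summable fun x : Site d => ∑' N, lacePi d p N x :=
  hfam.prod_symm.prod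

/-- `N ↦ Σ_x Π^{(N)}_p(x)` is summable. [folklore] -/
theorem summable_tsum_lacePi_nat : Summable fun N => ∑' x : Site d, lacePi d p N x :=
  hfam.prod

/-- `Σ_x Π^{(M)}_p(x) → 0` as `M → ∞` (the general term of a convergent series).
[cite: HeydenreichVanDerHofstad2017, (6.3.4)] -/
theorem tendsto_tsum_lacePi_atTop :
    Tendsto (fun M => ∑' x : Site d, lacePi d p M x) atTop (𝓝 0) :=
  (summable_tsum_lacePi_nat hfam).tendsto_atTop_zero

/-- The alternating series converges absolutely at every `x`. [cite: HeydenreichVanDerHofstad2017, (6.3.3)] -/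
theorem summable_lacePiSum_nat (x : Site d) : Summable fun N => (-1 : ℝ) ^ N * lacePi d p N x :=
  Summable.of_norm_bounded (summable_lacePi_nat hfam x) fun N => by
    rw [norm_mul, norm_pow, norm_neg, norm_one, one_pow, one_mul, Real.norm_eq_abs,
      abs_of_nonneg (lacePi_nonneg p N x)]

/-- `|Π_p(x)| ≤ Σ_N Π^{(N)}_p(x)`. [cite: HeydenreichVanDerHofstad2017, (6.3.3)] -/
theorem abs_lacePiSum_le (x : Site d) : |lacePiSum d p x| ≤ ∑' N, lacePi d p N x := by
  have habsN : ∀ N, ‖(-1 : ℝ) ^ N * lacePi d p N x‖ = lacePi d p N x := fun N => by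
    rw [norm_mul, norm_pow, norm_neg, norm_one, one_pow, one_mul, Real.norm_eq_abs,
      abs_of_nonneg (lacePi_nonneg p N x)]
  rw [lacePiSum_def, ← Real.norm_eq_abs]
  refine (norm_tsum_le_tsum_norm ?_).trans (le_of_eq (tsum_congr habsN))
  exact (summable_lacePi_nat hfam x).congr fun N => (habsN N).symm

/-- `Π_p` is absolutely summable. [cite: HeydenreichVanDerHofstad2017, (6.3.3)] -/
theorem summable_abs_lacePiSum : Summable fun x => |lacePiSum d p x| :=
  Summable.of_nonneg_of_le (fun _ => abs_nonneg _) (abs_lacePiSum_le hfam) (summable_tsum_lacePi hfam)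

/-- `Π_p` is summable. [folklore] -/
theorem summable_lacePiSum : Summable (lacePiSum d p) :=
  (summable_abs_lacePiSum hfam).of_abs

/-- `Σ_x |Π_p(x)| ≤ Σ_x Σ_N Π^{(N)}_p(x)`. [cite: HeydenreichVanDerHofstad2017, (6.3.3) and (8.3.1)] -/
theorem tsum_abs_lacePiSum_le : ∑' x, |lacePiSum d p x| ≤ ∑' x, ∑' N, lacePi d p N x :=
  (summable_abs_lacePiSum hfam).tsum_le_tsum (abs_lacePiSum_le hfam) (summable_tsum_lacePi hfam)

/-- `Σ_x |Π_p(x)| ≤ Σ_N Σ_x Π^{(N)}_p(x)` (the order of summation in which the diagrammatic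
estimates are stated). [cite: HeydenreichVanDerHofstad2017, (8.3.1) from (8.3.5)] -/
theorem tsum_abs_lacePiSum_le_tsum_tsum : ∑' x, |lacePiSum d p x| ≤ ∑' N, ∑' x, lacePi d p N x := by
  rw [← hfam.tsum_comm]; exact tsum_abs_lacePiSum_le hfam

/-- **(6.1.2) from (6.2.2) by `M → ∞`**: for `d ≥ 2` and `p < p_c`, if `Σ_N Σ_x Π^{(N)}_p(x) < ∞`
then `τ_p(x) = δ₀(x) + (J⋆τ_p)(x) + (Π_p ⋆ (J⋆τ_p))(x) + Π_p(x)` with `J = p𝟙{· ∼ 0}` (`bondJ`):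
`Π_M(x) → Π_p(x)` ((6.3.3)), `(Π_M ⋆ J⋆τ)(x) → (Π_p ⋆ J⋆τ)(x)` by dominated convergence (majorant
`2dp Σ_N Π^{(N)}`), and `|R_M(x)| ≤ (Π^{(M)} ⋆ J ⋆ τ)(x) ≤ 2dp Σ_u Π^{(M)}(u) → 0` ((6.3.2)–(6.3.4)).
[cite: HeydenreichVanDerHofstad2017, §6.3 ((6.3.1)–(6.3.4)) and (6.1.2)] -/
theorem tau_eq_laceIdentity_of_summable (hd : 2 ≤ d)
    (hp : (p : ℝ) < criticalProb (zdGraph d) (0 : Site d)) (x : Site d) :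
    tau d p 0 x = delta0 x + latticeConv (bondJ d p) (tau d p 0) x
      + latticeConv (lacePiSum d p) (latticeConv (bondJ d p) (tau d p 0)) x + lacePiSum d p x := by
  have hd1 : 1 ≤ d := by omega
  set Jτ : Site d → ℝ := latticeConv (bondJ d p) (tau d p 0) with hJτdef
  have hq0 : (0 : ℝ) ≤ 2 * d * (p : ℝ) := by have := p.2.1; positivity
  have hJτ0 : ∀ x, 0 ≤ Jτ x := fun x =>
    latticeConv_nonneg (bondJ_nonneg p) (fun y => tau_nonneg p 0 y) x
  have hJτle : ∀ x, Jτ x ≤ 2 * d * (p : ℝ) := fun x =>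
    latticeConv_bondJ_le hd1 p (fun y => tau_nonneg p 0 y) (fun y => tau_le_one p 0 y) x
  have hsum : ∀ N, Summable (lacePi d p N) := summable_lacePi_of_uncurry hfam
  have hsumN : ∀ x, Summable fun N => lacePi d p N x := summable_lacePi_nat hfam
  -- the majorant `G = Σ_N Π^{(N)}`
  set G : Site d → ℝ := fun x => ∑' N, lacePi d p N x with hGdef
  have hG : Summable G := summable_tsum_lacePi hfam
  have hG0 : ∀ x, 0 ≤ G x := fun x => tsum_nonneg fun N => lacePi_nonneg p N x
  have habsN : ∀ N x, |(-1 : ℝ) ^ N * lacePi d p N x| = lacePi d p N x := fun N x => by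
    rw [abs_mul, abs_pow, abs_neg, abs_one, one_pow, one_mul, abs_of_nonneg (lacePi_nonneg p N x)]
  -- `Π_M(u) → Π_p(u)`
  have h1u : ∀ u, Tendsto (fun M => lacePiM d p M u) atTop (𝓝 (lacePiSum d p u)) := fun u => by
    have h := (summable_lacePiSum_nat hfam u).hasSum.tendsto_sum_nat
    have h' := h.comp (tendsto_add_atTop_nat 1)
    refine h'.congr fun M => ?_
    simp only [Function.comp_apply, lacePiM_def]
  -- `|Π_M(u)| ≤ G(u)`
  have hPiMG : ∀ M u, |lacePiM d p M u| ≤ G u := fun M u => by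
    rw [lacePiM_def]
    calc |∑ N ∈ Finset.range (M + 1), (-1 : ℝ) ^ N * lacePi d p N u|
        ≤ ∑ N ∈ Finset.range (M + 1), |(-1 : ℝ) ^ N * lacePi d p N u| := Finset.abs_sum_le_sum_abs _ _
      _ = ∑ N ∈ Finset.range (M + 1), lacePi d p N u := Finset.sum_congr rfl fun N _ => habsN N u
      _ ≤ G u := (hsumN u).sum_le_tsum _ fun N _ => lacePi_nonneg p N u
  -- `(Π_M ⋆ Jτ)(x) → (Π_p ⋆ Jτ)(x)`
  have h2 : Tendsto (fun M => latticeConv (lacePiM d p M) Jτ x) atTop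
      (𝓝 (latticeConv (lacePiSum d p) Jτ x)) := by
    unfold latticeConv
    refine tendsto_tsum_of_dominated_convergence (bound := fun u => G u * (2 * d * (p : ℝ)))
      (hG.mul_right _) (fun u => (h1u u).mul_const _) (Eventually.of_forall fun M u => ?_)
    rw [norm_mul, Real.norm_eq_abs, Real.norm_eq_abs, abs_of_nonneg (hJτ0 _)]
    exact mul_le_mul (hPiMG M u) (hJτle _) (hJτ0 _) (hG0 u)
  -- `R_M(x) → 0`
  have h3 : Tendsto (fun M => laceR d p M x) atTop (𝓝 0) := by
    refine squeeze_zero_norm' (a := fun M => (∑' u, lacePi d p M u) * (2 * d * (p : ℝ))) ?_ ?_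
    · refine eventually_atTop.2 ⟨1, fun M hM => ?_⟩
      rw [Real.norm_eq_abs]
      have hfun : (fun u => (lacePiT d p M u).toReal) = lacePi d p M :=
        funext fun u => (lacePi_of_ne (Or.inl (by omega))).symm
      calc |laceR d p M x| ≤ latticeConv (fun u => (lacePiT d p M u).toReal) Jτ x :=
            HvdH2017_eq632_holds d hd p hp M x
        _ = latticeConv (lacePi d p M) Jτ x := by rw [hfun]
        _ ≤ (∑' u, lacePi d p M u) * (2 * d * (p : ℝ)) :=
            latticeConv_le_tsum_mul (hsum M) (lacePi_nonneg p M) hJτ0 hJτle x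
    · simpa using (tendsto_tsum_lacePi_atTop hfam).mul_const (2 * d * (p : ℝ))
  have hconst : Tendsto (fun M => delta0 x + Jτ x + latticeConv (lacePiM d p M) Jτ x + lacePiM d p M x
      + laceR d p M x) atTop (𝓝 (tau d p 0 x)) :=
    tendsto_const_nhds.congr fun M => HvdH2017_prop61_holds d hd p hp M x
  have hlim' : Tendsto (fun M => delta0 x + Jτ x + latticeConv (lacePiM d p M) Jτ x + lacePiM d p M x
      + laceR d p M x) atTop (𝓝 (delta0 x + Jτ x + latticeConv (lacePiSum d p) Jτ x + lacePiSum d p x + 0)) :=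
    (((tendsto_const_nhds.add tendsto_const_nhds).add h2).add (h1u x)).add h3
  have := tendsto_nhds_unique hconst hlim'
  rw [this, add_zero]

end Summable

/-! ### Hara's kernel `J = 2dp D ⋆ (δ₀ + Φ)` is `bondJ ⋆ laceSource Φ` -/

/-- `g = δ₀ + Φ` pointwise. [cite: Hara2008, Prop. 1.2 (ĝ_p = 1 + Π̂_p)] -/
theorem laceSource_eq_delta0_add (Φ : Site d → ℝ) (x : Site d) : laceSource Φ x = delta0 x + Φ x := rfl

/-- **`J = (p𝟙{· ∼ 0}) ⋆ (δ₀ + Φ)`**: Hara's `J(y) = p Σ_i [g(y + e_i) + g(y - e_i)]` is the lattice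
convolution of the one-step kernel `bondJ d p = 2dpD` with `g = laceSource Φ`.
[cite: Hara2008, Prop. 1.2 (Ĵ_p = 2dp D̂ ĝ_p)] [cite: HeydenreichVanDerHofstad2017, (6.2.1) and (11.2.4)] -/
theorem laceKernel_eq_latticeConv (p : unitInterval) (Φ : Site d → ℝ) (y : Site d) :
    laceKernel p Φ y = latticeConv (bondJ d p) (laceSource Φ) y := by
  rw [latticeConv_bondJ, laceKernel]
  congr 1
  exact Finset.sum_congr rfl fun i _ => add_comm _ _

/-! ### Re-association of (6.1.2) into Hara's form `τ = g + (J ⋆ g) ⋆ τ` -/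

section Reassociation

variable {p : unitInterval} {Φ : Site d → ℝ}

/-- `(Φ ⋆ (J ⋆ τ))(x) = (J ⋆ (Φ ⋆ τ))(x)` for `Φ ∈ ℓ¹` (`J ∈ ℓ¹`, `0 ≤ τ ≤ 1`): both equal
`((Φ ⋆ J) ⋆ τ)(x) = ((J ⋆ Φ) ⋆ τ)(x)` (Fubini). [folklore] -/
theorem latticeConv_latticeConv_bondJ_tau_comm (hd : 1 ≤ d) (hΦ : Summable fun x => |Φ x|)
    (x : Site d) :
    latticeConv Φ (latticeConv (bondJ d p) (tau d p 0)) x =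
      latticeConv (bondJ d p) (latticeConv Φ (tau d p 0)) x := by
  have hJ : Summable fun x => |bondJ d p x| :=
    (summable_bondJ hd p).congr fun x => (abs_of_nonneg (bondJ_nonneg p x)).symm
  have hτ : ∀ y, |tau d p 0 y| ≤ 1 := fun y => by
    rw [abs_of_nonneg (tau_nonneg p 0 y)]; exact tau_le_one p 0 y
  rw [← latticeConv_assoc_of_bdd hΦ hJ hτ, ← latticeConv_assoc_of_bdd hJ hΦ hτ]
  have hcomm : latticeConv Φ (bondJ d p) = latticeConv (bondJ d p) Φ :=
    funext fun y => latticeConv_comm _ _ y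
  rw [hcomm]

/-- `((J ⋆ g) ⋆ τ)(x) = (J⋆τ)(x) + (J ⋆ (Φ ⋆ τ))(x)` with `g = δ₀ + Φ`, `Φ ∈ ℓ¹`. [folklore] -/
theorem latticeConv_laceKernel_tau (hd : 1 ≤ d) (hΦ : Summable fun x => |Φ x|) (x : Site d) :
    latticeConv (laceKernel p Φ) (tau d p 0) x =
      latticeConv (bondJ d p) (tau d p 0) x +
        latticeConv (bondJ d p) (latticeConv Φ (tau d p 0)) x := by
  have hJ : Summable fun x => |bondJ d p x| :=
    (summable_bondJ hd p).congr fun x => (abs_of_nonneg (bondJ_nonneg p x)).symm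
  have hτ : ∀ y, |tau d p 0 y| ≤ 1 := fun y => by
    rw [abs_of_nonneg (tau_nonneg p 0 y)]; exact tau_le_one p 0 y
  have hg : Summable fun x => |laceSource Φ x| := by
    refine Summable.of_nonneg_of_le (fun _ => abs_nonneg _) (fun x => ?_) (hasSum_delta0.summable.abs.add hΦ)
    rw [laceSource_eq_delta0_add]
    exact abs_add_le _ _
  have hker : laceKernel p Φ = latticeConv (bondJ d p) (laceSource Φ) :=
    funext fun y => laceKernel_eq_latticeConv p Φ y
  rw [hker, latticeConv_assoc_of_bdd hJ hg hτ]
  -- `(g ⋆ τ)(v) = τ(v) + (Φ ⋆ τ)(v)`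
  have hgτ : latticeConv (laceSource Φ) (tau d p 0) = fun v => tau d p 0 v + 1 * latticeConv Φ (tau d p 0) v := by
    funext v
    have h1 : Summable fun y => delta0 y * tau d p 0 (v - y) :=
      Summable.of_norm_bounded hasSum_delta0.summable.abs fun y => by
        rw [Real.norm_eq_abs, abs_mul]
        exact mul_le_of_le_one_right (abs_nonneg _) (hτ _)
    have h2 : Summable fun y => Φ y * tau d p 0 (v - y) :=
      Summable.of_norm_bounded hΦ fun y => by
        rw [Real.norm_eq_abs, abs_mul]
        exact mul_le_of_le_one_right (abs_nonneg _) (hτ _)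
    have h := latticeConv_add_smul_left (g := tau d p 0) (f₁ := delta0) (f₂ := Φ) 1 (x := v) h1
      (by simpa using h2)
    simp only [one_mul] at h
    rw [show laceSource Φ = fun y => delta0 y + Φ y from funext fun y => laceSource_eq_delta0_add Φ y]
    rw [h, latticeConv_delta0_left, one_mul]
  rw [hgτ]
  -- linearity of `J ⋆ ·` in the right slot
  have hJτs : Summable fun y => bondJ d p y * tau d p 0 (x - y) :=
    Summable.of_norm_bounded hJ fun y => by
      rw [Real.norm_eq_abs, abs_mul]
      exact mul_le_of_le_one_right (abs_nonneg _) (hτ _)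
  have hΦτb : ∀ v, |latticeConv Φ (tau d p 0) v| ≤ ∑' y, |Φ y| := fun v => by
    have hle : ∀ y, ‖Φ y * tau d p 0 (v - y)‖ ≤ |Φ y| := fun y => by
      rw [Real.norm_eq_abs, abs_mul]; exact mul_le_of_le_one_right (abs_nonneg _) (hτ _)
    have hs : Summable fun y => ‖Φ y * tau d p 0 (v - y)‖ :=
      Summable.of_nonneg_of_le (fun _ => norm_nonneg _) hle hΦ
    unfold latticeConv
    rw [← Real.norm_eq_abs]
    exact (norm_tsum_le_tsum_norm hs).trans (hs.tsum_le_tsum hle hΦ)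
  have hJΦτs : Summable fun y => bondJ d p y * latticeConv Φ (tau d p 0) (x - y) :=
    Summable.of_norm_bounded (hJ.mul_right (∑' y, |Φ y|)) fun y => by
      rw [Real.norm_eq_abs, abs_mul]
      exact mul_le_mul_of_nonneg_left (hΦτb _) (abs_nonneg _)
  rw [latticeConv_add_smul_right 1 hJτs hJΦτs, one_mul]

end Reassociation

/-! ### The bridge -/

/-- **`Π_p` is a lace coefficient at `p` (`IsLaceCoefficientAt`) whenever `Σ_N Σ_x Π^{(N)}_p(x) < ∞`**,
`d ≥ 2`, `p < p_c`: symmetry (`isZdSymmetric_lacePiSum`), absolute summability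
(`summable_abs_lacePiSum`) and the expansion `τ_p(x) = g(x) + Σ_y J(y) τ_p(x - y)`, `g = δ₀ + Π_p`,
`J = 2dp D ⋆ g` — (6.1.2) (`tau_eq_laceIdentity_of_summable`) with
`J⋆τ + Π_p ⋆ (J⋆τ) = (J ⋆ g) ⋆ τ`. This is Heydenreich–van der Hofstad's Cor. 8.13 (8.5.1) in
`x`-space for one `p < p_c`, conditionally on the convergence of the expansion at that `p`.
[cite: HeydenreichVanDerHofstad2017, (6.1.2), §6.3 ((6.3.3)–(6.3.4)) and Cor. 8.13 ((8.5.1))]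
[cite: Hara2008, Prop. 1.2 and Appendix A (item 1)] -/
theorem isLaceCoefficientAt_lacePiSum (hd : 2 ≤ d) {p : unitInterval} (hp : p < criticalProbI d)
    (hfam : Summable (Function.uncurry (lacePi d p))) : IsLaceCoefficientAt d p (lacePiSum d p) := by
  have hp' : (p : ℝ) < criticalProb (zdGraph d) (0 : Site d) := by
    rw [← coe_criticalProbI]; exact_mod_cast hp
  refine ⟨isZdSymmetric_lacePiSum p, summable_abs_lacePiSum hfam, fun x => ?_⟩
  have h := tau_eq_laceIdentity_of_summable hfam hd hp' x
  have hconv : ∑' y, laceKernel p (lacePiSum d p) y * tau d p 0 (x - y) =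
      latticeConv (laceKernel p (lacePiSum d p)) (tau d p 0) x := rfl
  rw [hconv, latticeConv_laceKernel_tau (by omega) (summable_abs_lacePiSum hfam),
    ← latticeConv_latticeConv_bondJ_tau_comm (by omega) (summable_abs_lacePiSum hfam),
    laceSource_eq_delta0_add, h]
  ring

/-- **Every subcritical lace coefficient is `Π_p`**: for `d ≥ 2`, `p < p_c` and
`Σ_N Σ_x Π^{(N)}_p(x) < ∞`, any `Φ` with `IsLaceCoefficientAt d p Φ` equals `lacePiSum d p`
(uniqueness below `p_c`, `IsLaceCoefficientAt.unique`). In particular the family `(Φ_p)_{p<p_c}`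
of `Hara2008_prop12Subcrit` consists of the Hara–Slade coefficients wherever the expansion converges.
[cite: HeydenreichVanDerHofstad2017, Exercise 6.1 and (6.1.1)] -/
theorem IsLaceCoefficientAt.eq_lacePiSum (hd : 2 ≤ d) {p : unitInterval} (hp : p < criticalProbI d)
    (hfam : Summable (Function.uncurry (lacePi d p))) {Φ : Site d → ℝ}
    (h : IsLaceCoefficientAt d p Φ) : Φ = lacePiSum d p :=
  IsLaceCoefficientAt.unique hd hp h (isLaceCoefficientAt_lacePiSum hd hp hfam)

/-- A convenient sufficient condition for the convergence hypothesis: row summability with summable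
row sums (Tonelli for the nonnegative family `Π^{(N)}_p(x)`), e.g. from `Σ_x Π^{(N)}_p ≤ g(N)` with
`Σ_N g(N) < ∞` as delivered by the diagrammatic estimates.
[cite: HeydenreichVanDerHofstad2017, proof of Prop. 8.3 (summing (8.3.5) over N)] -/
theorem summable_uncurry_lacePi_of_le {p : unitInterval} (hrow : ∀ N, Summable (lacePi d p N))
    {g : ℕ → ℝ} (hg : Summable g) (hle : ∀ N, ∑' x, lacePi d p N x ≤ g N) :
    Summable (Function.uncurry (lacePi d p)) := by
  refine (summable_prod_of_nonneg fun q => lacePi_nonneg p q.1 q.2).2 ⟨hrow, ?_⟩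
  exact Summable.of_nonneg_of_le (fun N => tsum_nonneg fun x => lacePi_nonneg p N x) hle hg

end Literature.Barriers.CriticalPhenomena

end
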